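import Literature.IUT.HodgeArakelov.TwoSectionsNonVacuity
import HarnessLib

/-!
# [IUTchII] Rmk. 1.1.1 (iii): NON-VACUITY of `TwoSections` over the core tower of (P1) and at every level of the
# natural system of `X̲̲_K`

Mochizuki, *Inter-universal Teichmüller theory II*, §1, Remark 1.1.1 (iii), kurims manuscript (Dec. 2020) pp. 22–23
[claim: Mochizuki2012, status: disputed] (IUTchII §1 Rmk 1.1.1 (iii), kurims pp.22-23). abc-iut cell, layer L6, NV-L6
row **TwoSections** (seat abc-iut-w5-d225 gen 5): corollaries of `TwoSectionsNonVacuity.lean`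
(`ModelFrame.exists_twoSections_of_coreTower`): over the core tower of `CoreTowerNonVacuity.lean`
(`exists_twoSections_of_cLevelData`, `T.thetaSection` and `W.PiC = Π^tp_C` pinned; `exists_nonempty_twoSections_of_cLevelData`)
and at every level `M ∈ ℕ_{≥1}` of the natural projective system of MODEL mono-theta environments of `X̲̲_K` (abc-iut-w4-d030's
`EtaleLevels.modelRecon`, B8 part 5c, identity frame), the Def. 1.1 (i) output carries theta-quotient data `T`, a core
tower `W` and a `TwoSections T W` (GENUINE witness over the C-level data of a `MuTwoSetting`, under `IsEtThOrigin` +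
`hYcl`). PROOF-ONLY. HONEST FRAMING: a kernel fact about the cell's own typed interfaces; nothing of [IUTchII] is
asserted; no side taken on [IUTchIII] Cor. 3.12 (node outside the cone); typed ≠ discharged.
[cite: MochizukiEtTh2009, Prop 2.12 (i) p.45]
-/

noncomputable section

namespace Literature.IUT.HodgeArakelov

open Literature.AnabelianGeometry.EtaleTheta Literature.AnabelianGeometry.SemiGraphs
open scoped Literature.AnabelianGeometry.EtaleTheta

namespace ModelFrame

variable {p : ℕ} [Fact p.Prime] {Mt : MuTwoSetting p}
  {E : Mt.toThetaSetting.EtaleThetaData} {l : ℕ} (C : E.DoubleUnderline l)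
  {S : ThetaSetting.{0}} (μ : Mt.toThetaSetting.CyclotomeMod l S.N)
  (hC : Mt.toThetaSetting.Compat) (hS : Mt.toThetaSetting.Sec2Hyps)
  (h15 : ThetaSetting.Prop15iii E hC) (L : C.CuspLabels)
  (F : ModelFrame S (C.rigidData μ hC hS h15 L)) {Menv : MonoThetaEnv S}
  (e : Menv.Pi ≃ₜ* (C.rigidData μ hC hS h15 L).env)

/-- **IUTchII:Rmk1.1.1(iii) — `TwoSections` over the core tower of (P1)**: with the C-level record `cl`, there are
`T`, `W` with `T.thetaSection = e⁻¹(s^alg(thetaKer))`, `W.PiC = Π^tp_C` and a `TwoSections T W` (GENUINE witness: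
`exists_twoSections_of_coreTower` at the tower of `exists_coreTower_of_cLevelData`).
[claim: Mochizuki2012, status: disputed] (IUTchII §1 Rmk 1.1.1 (iii), kurims pp.22-23) -/
theorem exists_twoSections_of_cLevelData (cl : Mt.CLevelData) (hO : Mt.toThetaSetting.IsEtThOrigin)
    (hYcl : (Mt.DtpY.map Mt.toHat.toMonoidHom).topologicalClosure ≤
      Mt.DtpY.map Mt.toHat.toMonoidHom ⊔ (⁅⁅Mt.DeltaHat, Mt.DeltaHat⁆, Mt.DeltaHat⁆).topologicalClosure) :
    ∃ (T : ThetaQuotientData (F.reconstruction e)) (W : CoreTower (F.reconstruction e)),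
      T.thetaSection = (((C.rigidData μ hC hS h15 L).thetaKer.subgroupOf (C.rigidData μ hC hS h15 L).PiY).map
          (CycEnvelope.algSection (C.rigidData μ hC hS h15 L).augY (C.rigidData μ hC hS h15 L).chi)).comap
          e.toMulEquiv.toMonoidHom ∧
      W.PiC = TopGroup.of Mt.GtpC ∧ Nonempty (TwoSections T W) := by
  obtain ⟨W, hWC, hWker⟩ := exists_coreTower_of_cLevelData C μ hC hS h15 L F e cl hO hYcl
  obtain ⟨T, hT, hSec⟩ := exists_twoSections_of_coreTower C μ hC hS h15 L F e hO hYcl W hWker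
  exact ⟨T, W, hT, hWC, hSec⟩

/-- **IUTchII:Rmk1.1.1(iii) — `TwoSections` is INHABITED at the [EtTh] model** (some `T`, `W`; GENUINE witness).
[claim: Mochizuki2012, status: disputed] (IUTchII §1 Rmk 1.1.1 (iii), kurims pp.22-23) -/
theorem exists_nonempty_twoSections_of_cLevelData (cl : Mt.CLevelData) (hO : Mt.toThetaSetting.IsEtThOrigin)
    (hYcl : (Mt.DtpY.map Mt.toHat.toMonoidHom).topologicalClosure ≤
      Mt.DtpY.map Mt.toHat.toMonoidHom ⊔ (⁅⁅Mt.DeltaHat, Mt.DeltaHat⁆, Mt.DeltaHat⁆).topologicalClosure) :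
    ∃ (T : ThetaQuotientData (F.reconstruction e)) (W : CoreTower (F.reconstruction e)),
      Nonempty (TwoSections T W) := by
  obtain ⟨T, W, -, -, h⟩ := exists_twoSections_of_cLevelData C μ hC hS h15 L F e cl hO hYcl
  exact ⟨T, W, h⟩

end ModelFrame

/-! ## At every level `M` of the natural system of `X̲̲_K` (B8 part 5c) -/

namespace EtaleLevels

variable {p : ℕ} [Fact p.Prime] {Mt : MuTwoSetting p}
  {E : Mt.toThetaSetting.EtaleThetaData} {l : ℕ} (C : E.DoubleUnderline l)
  (hC : Mt.toThetaSetting.Compat) (hS : Mt.toThetaSetting.Sec2Hyps)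
  (hl : l.Prime) (hp2 : p ≠ 2) (hpl : p ≠ l) (hζ : ∃ ζ : Mt.K, IsPrimitiveRoot ζ (4 * l))
  (mods : ∀ M : ℕ+, Mt.toThetaSetting.CyclotomeMod l M)
  (f : contCocycles Mt.toTheta Mt.DeltaTheta C.GtpYdduu) (hf : f ∈ C.rootCocycles hC)
  (h15 : ThetaSetting.Prop15iii E hC) (L : C.CuspLabels)
  (hZ : ∀ M : ℕ+, Nonempty (ModelCyclotomes.lDeltaQuot (C.rigidData (mods M) hC hS h15 L) ≃*
    Literature.IUT.HodgeTheaters.ZHat))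

/-- **`TwoSections` EXISTS at every level `M` of the natural system of model mono-theta environments of `X̲̲_K`**
(abc-iut-w4-d030's `EtaleLevels.modelRecon`, identity frame), GENUINE witness over the C-level data, under
`IsEtThOrigin` + `hYcl`. [claim: Mochizuki2012, status: disputed] (IUTchII §1 Rmk 1.1.1 (iii), kurims pp.22-23) -/
theorem exists_twoSections_modelRecon (cl : Mt.CLevelData) (hO : Mt.toThetaSetting.IsEtThOrigin)
    (hYcl : (Mt.DtpY.map Mt.toHat.toMonoidHom).topologicalClosure ≤
      Mt.DtpY.map Mt.toHat.toMonoidHom ⊔ (⁅⁅Mt.DeltaHat, Mt.DeltaHat⁆, Mt.DeltaHat⁆).topologicalClosure)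
    (M : ℕ+) :
    ∃ (T : ThetaQuotientData (modelRecon C hC hS hl hp2 hpl hζ mods f hf h15 L hZ M))
      (W : CoreTower (modelRecon C hC hS hl hp2 hpl hζ mods f hf h15 L hZ M)), Nonempty (TwoSections T W) := by
  unfold modelRecon
  exact ModelFrame.exists_nonempty_twoSections_of_cLevelData (S := levelSetting C hC hS hl hp2 hpl hζ mods f hf M)
    C (mods M) hC hS h15 L (modelFrame C hC hS hl hp2 hpl hζ mods f hf h15 L hZ M) _ cl hO hYcl

end EtaleLevels

end Literature.IUT.HodgeArakelov

end
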